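import Literature.NumberTheory.EllipticCurves.GaloisActionProofs
import Literature.NumberTheory.EllipticCurves.KummerMap
import Literature.NumberTheory.GaloisRepresentations.AbsGaloisGroup
import HarnessLib

/-!
# Route `GenusKolyvaginAtTwo`, LINE 18 «plus_descent» on crux L_T `PowDvdShaCardAtTwoRT`
# (stmt-BirchSwinnertonDyer-23242): the registered stub `stub_fixedPartCyclic` — the `c₀`-fixed part of
# `E[2^M]` on `Δ < 0` is cyclic of order `2^M`

Seat `bsd-line-gk2-p3` g15 (cell `bsd-f1-sign2`), `--supports stmt-BirchSwinnertonDyer-23242` (helper; closes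
nothing). THEOREMS ONLY (no definition, no named fact, no `sorry`); BSD is not proved by any of this.

The pen's skeleton `Cruxes/PowDvdShaCardAtTwoRT/Lines/plus_descent.lean` (pen bsd-idea-1 g10, 2026-08-28) registers

  `stub_fixedPartCyclic : (Q1-shape: ∀ W, Δ < 0 → ∀ c₀ complex conjugation → ∀ M, ∃ P ∈ E[2^M] with
     E[2^M] = {a·P + b·c₀P}) → CyclicFixedPartOfNegDisc`,
  `CyclicFixedPartOfNegDisc := ∀ W, Δ < 0 → ∀ c₀ → ∀ M, ∃ P ∈ E[2^M], addOrderOf P = 2^M ∧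
     ∀ Q ∈ E[2^M], (c₀ • Q = Q ↔ Q ∈ ℤ·P)`

("free of rank one over `(ℤ/2^M)[C₂]` ⟹ invariants = the norm line `⟨P + c₀P⟩`", McCallum 1991 Lemma 5.3 /
Gross 1991 (3.3) read over `ℚ`: it is what makes `E(ℚ_ℓ)/2^M = E[2^M]^{Frob_ℓ = τ}` cyclic of order `2^M` at an
inert Kolyvagin prime). This file proves it, with the def UNFOLDED (a `Theorems` file cannot import `Cruxes`):

* `addOrderOf_norm_and_smul_eq_self_iff` — the algebra: for an involution `c₀` (`c₀² = 1`) of `Γ_ℚ` and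
  `P ∈ E[2^M]` with `E[2^M] = {aP + b c₀P : a, b ∈ ℤ}`, the norm `N = P + c₀P` has order `2^M` and
  `E[2^M]^{c₀} = ℤ·N`. Freeness of `(P, c₀P)` over `ℤ/2^M` is COUNTING: `(a, b) ↦ aP + b c₀P` is onto `E[2^M]`
  from `(ℤ/2^M)²`, both of order `4^M` (`card_torsionPoints_eq_sq_holds`), hence injective; then
  `c₀Q = Q` for `Q = aP + b c₀P` reads `(a−b)(P − c₀P) = 0`, i.e. `2^M ∣ a − b`, i.e. `Q = bN`.
* `cyclicFixedPart_of_cyclicTorsion` — the registered stub VERBATIM (with `CyclicFixedPartOfNegDisc` unfolded);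
* (sibling `…FixedPartCyclicHolds`: the UNCONDITIONAL form, feeding the stub with the closed route item Q1
  `CyclicTorsionOfNegDisc`; kept apart so that THIS file stays outside the route's import cone).

References: [McCallumLMS1991] Lemma 5.3; [GrossLMS1991] §3 (3.3), §4; [SilvermanAEC2009] Cor. III.6.4(b).
-/

set_option autoImplicit false
set_option linter.dupNamespace false

noncomputable section

open scoped Classical

namespace Summit.BirchSwinnertonDyer.BirchSwinnertonDyer.Theorems.GenusExact.PlusDescent

open WeierstrassCurve Field
open Literature.NumberTheory.EllipticCurves Literature.NumberTheory.GaloisRepresentations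

/-! ## §1 The algebra: invariants of a free rank-one `(ℤ/2^M)[C₂]`-module -/

/-- `a • R` only depends on `a mod 2^M` when `2^M • R = 0`. [folklore] -/
private theorem val_intCast_zsmul {A : Type*} [AddCommGroup A] {M : ℕ} [NeZero (2 ^ M)] (a : ℤ) (R : A)
    (hR : ((2 ^ M : ℕ) : ℤ) • R = 0) : (((a : ZMod (2 ^ M)).val : ℤ)) • R = a • R := by
  rw [ZMod.val_intCast]
  conv_rhs => rw [← Int.emod_add_mul_ediv a ((2 ^ M : ℕ) : ℤ), add_zsmul, mul_smul, smul_comm, hR, smul_zero,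
    add_zero]

/-- **Invariants of a free rank-one `(ℤ/2^M)[C₂]`-module.** Let `c₀ ∈ Γ_ℚ` with `c₀² = 1` and `P ∈ E[2^M]`
with `E[2^M] = {aP + b·c₀P : a, b ∈ ℤ}`. Then `N = P + c₀P` has order `2^M` and the `c₀`-fixed subgroup of
`E[2^M]` is `ℤ·N`. [cite: McCallumLMS1991, Lemma 5.3 (the cyclic local groups)] [cite: GrossLMS1991, §3 (3.3)] -/
theorem addOrderOf_norm_and_smul_eq_self_iff (W : WeierstrassCurve ℚ) [W.IsElliptic] (M : ℕ)
    {c₀ : absoluteGaloisGroup ℚ} (hc₀ : c₀ * c₀ = 1) (P : geomTorsion W ((2 ^ M : ℕ) : ℤ))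
    (hgen : ∀ Q : geomTorsion W ((2 ^ M : ℕ) : ℤ), ∃ a b : ℤ, Q = a • P + b • (c₀ • P)) :
    addOrderOf (P + c₀ • P) = 2 ^ M ∧
      ∀ Q : geomTorsion W ((2 ^ M : ℕ) : ℤ), c₀ • Q = Q ↔ Q ∈ AddSubgroup.zmultiples (P + c₀ • P) := by
  haveI : NeZero (2 ^ M) := ⟨pow_ne_zero _ two_ne_zero⟩
  have h2M0 : ((2 ^ M : ℕ) : ℤ) ≠ 0 := by exact_mod_cast pow_ne_zero M two_ne_zero
  -- finiteness and `#E[2^M] = 4^M`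
  haveI hfin : Finite (geomTorsion W ((2 ^ M : ℕ) : ℤ)) :=
    finite_torsionPoints_holds W (AlgebraicClosure ℚ) h2M0
  have hcard : Nat.card (geomTorsion W ((2 ^ M : ℕ) : ℤ)) = (2 ^ M) ^ 2 :=
    card_torsionPoints_eq_sq_holds W (AlgebraicClosure ℚ) (n := 2 ^ M)
      (by exact_mod_cast pow_ne_zero M (two_ne_zero (α := AlgebraicClosure ℚ)))
  -- `2^M` kills `P` and `c₀P`
  have hPn : ((2 ^ M : ℕ) : ℤ) • P = 0 :=
    Subtype.ext ((mem_geomTorsion_iff W _ (P : geomPoints W)).mp P.2)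
  have hcPn : ((2 ^ M : ℕ) : ℤ) • (c₀ • P) = 0 := by rw [smul_comm, hPn, smul_zero]
  -- freeness of `(P, c₀P)` over `ℤ/2^M`, by counting
  have hfree : ∀ a b : ℤ, a • P + b • (c₀ • P) = 0 → ((2 ^ M : ℕ) : ℤ) ∣ a ∧ ((2 ^ M : ℕ) : ℤ) ∣ b := by
    letI : Fintype (geomTorsion W ((2 ^ M : ℕ) : ℤ)) := Fintype.ofFinite _
    let f : ZMod (2 ^ M) × ZMod (2 ^ M) → geomTorsion W ((2 ^ M : ℕ) : ℤ) :=
      fun x ↦ ((x.1.val : ℤ)) • P + ((x.2.val : ℤ)) • (c₀ • P)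
    have hf : ∀ a b : ℤ, f ((a : ZMod (2 ^ M)), (b : ZMod (2 ^ M))) = a • P + b • (c₀ • P) := fun a b ↦ by
      simp only [f]
      rw [val_intCast_zsmul a P hPn, val_intCast_zsmul b (c₀ • P) hcPn]
    have hsurj : Function.Surjective f := fun Q ↦ by
      obtain ⟨a, b, rfl⟩ := hgen Q
      exact ⟨((a : ZMod (2 ^ M)), (b : ZMod (2 ^ M))), hf a b⟩
    have hbij : Function.Bijective f := (Fintype.bijective_iff_surjective_and_card f).mpr ⟨hsurj, by
      rw [Fintype.card_prod, ZMod.card, ← Nat.card_eq_fintype_card, hcard, sq]⟩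
    intro a b hab
    have h0 : f ((a : ZMod (2 ^ M)), (b : ZMod (2 ^ M))) = f (((0 : ℤ) : ZMod (2 ^ M)), ((0 : ℤ) : ZMod (2 ^ M))) := by
      rw [hf, hf, hab, zero_zsmul, zero_zsmul, add_zero]
    have h1 := hbij.1 h0
    simp only [Prod.mk.injEq, Int.cast_zero] at h1
    exact ⟨(ZMod.intCast_zmod_eq_zero_iff_dvd a _).mp h1.1, (ZMod.intCast_zmod_eq_zero_iff_dvd b _).mp h1.2⟩
  -- the norm `N = P + c₀P`
  have hccP : c₀ • (c₀ • P) = P := by rw [← mul_smul, hc₀, one_smul]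
  have hc₀N : c₀ • (P + c₀ • P) = P + c₀ • P := by rw [smul_add, hccP, add_comm]
  have hNn : ((2 ^ M : ℕ) : ℤ) • (P + c₀ • P) = 0 := by rw [zsmul_add, hPn, hcPn, add_zero]
  refine ⟨?_, fun Q ↦ ⟨fun hQ ↦ ?_, ?_⟩⟩
  · -- order of `N`
    refine Nat.dvd_antisymm (addOrderOf_dvd_of_nsmul_eq_zero ?_) ?_
    · rw [← natCast_zsmul]; exact hNn
    · have h := addOrderOf_nsmul_eq_zero (P + c₀ • P)
      rw [← natCast_zsmul, zsmul_add] at h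
      obtain ⟨hd, -⟩ := hfree _ _ h
      exact_mod_cast hd
  · -- `c₀Q = Q ⟹ Q = bN`
    obtain ⟨a, b, hab⟩ := hgen Q
    have hcQ : c₀ • Q = b • P + a • (c₀ • P) := by
      rw [hab, smul_add, smul_comm c₀ a P, smul_comm c₀ b (c₀ • P), hccP, add_comm]
    have hdiff : (a - b) • P + (b - a) • (c₀ • P) = 0 := by
      have e : (a - b) • P + (b - a) • (c₀ • P) = (a • P + b • (c₀ • P)) - (b • P + a • (c₀ • P)) := by
        simp only [sub_zsmul]; abel
      rw [e, ← hab, ← hcQ, hQ, sub_self]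
    obtain ⟨⟨k, hk⟩, -⟩ := hfree _ _ hdiff
    refine (AddSubgroup.mem_zmultiples_iff).mpr ⟨b, ?_⟩
    have ha : a = b + ((2 ^ M : ℕ) : ℤ) * k := by linear_combination hk
    rw [hab, ha, add_zsmul, mul_comm, mul_zsmul, hPn, zsmul_zero, add_zero, zsmul_add]
  · rintro ⟨k, rfl⟩
    rw [smul_comm, hc₀N]

/-! ## §2 The registered stub and its unconditional form -/

/-- **LINE 18 stub `stub_fixedPartCyclic` (registered on crux L_T 23242), VERBATIM with the def
`CyclicFixedPartOfNegDisc` unfolded:** the Q1-shape «`E[2^M] = ⟨P, c₀P⟩` for every complex conjugation `c₀`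
and every `M`, on `Δ < 0`» implies «the `c₀`-fixed part of `E[2^M]` is cyclic of order `2^M`» (generated by the
norm `P + c₀P`). [cite: McCallumLMS1991, Lemma 5.3] [cite: GrossLMS1991, §3 (3.3)] -/
theorem cyclicFixedPart_of_cyclicTorsion
    (hQ1 : ∀ (W : WeierstrassCurve ℚ) [W.IsElliptic], W.Δ < 0 → ∀ (c₀ : Field.absoluteGaloisGroup ℚ),
      Literature.NumberTheory.GaloisRepresentations.IsComplexConjugation (Rat.castHom ℝ) c₀ → ∀ (M : ℕ),
      ∃ P : W.geomTorsion ((2 ^ M : ℕ) : ℤ), ∀ Q : W.geomTorsion ((2 ^ M : ℕ) : ℤ),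
        ∃ a b : ℤ, Q = a • P + b • (c₀ • P)) :
    ∀ (W : WeierstrassCurve ℚ) [W.IsElliptic], W.Δ < 0 → ∀ (c₀ : Field.absoluteGaloisGroup ℚ),
      Literature.NumberTheory.GaloisRepresentations.IsComplexConjugation (Rat.castHom ℝ) c₀ → ∀ (M : ℕ),
      ∃ P : W.geomTorsion ((2 ^ M : ℕ) : ℤ), addOrderOf P = 2 ^ M ∧
        ∀ Q : W.geomTorsion ((2 ^ M : ℕ) : ℤ), c₀ • Q = Q ↔ Q ∈ AddSubgroup.zmultiples P := by
  intro W _ hΔ c₀ hc₀ M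
  obtain ⟨P, hgen⟩ := hQ1 W hΔ c₀ hc₀ M
  have hcc : c₀ * c₀ = 1 := by rw [← pow_two]; exact hc₀.sq_eq_one
  exact ⟨P + c₀ • P, addOrderOf_norm_and_smul_eq_self_iff W M hcc P hgen⟩

end Summit.BirchSwinnertonDyer.BirchSwinnertonDyer.Theorems.GenusExact.PlusDescent

end
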